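import Mathlib.MeasureTheory.Integral.Bochner.Basic
import Mathlib.MeasureTheory.Integral.Bochner.Set
import Mathlib.MeasureTheory.Measure.Lebesgue.Basic
import Mathlib.Analysis.Complex.Basic
import HarnessLib

/-!
# Route `PrimeLevelFamEdge`, crux K_B (stmt-Parity-20343), line `diagonal_kernel_split` rev 4, plan Ω,
# node **L7d part 2, leaf F1c — a pointwise bound on the unit box bounds the iterated unit-box integral, with NO
# integrability hypothesis** (L7D-PLAN rev 6 §6 F2: "pointwise in τ, then integrate the bound")

The family large sieve (F2b `norm_sum_family_levelFactor_le`) bounds the unit-box integrand `FAM(τ₁,τ₂)` pointwise for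
`τ ∈ (1/2,2)²`; off that box the integrand vanishes (the bumps `θ(τ₁)θ(τ₂)` of `Kern_x`). Then
`‖∫dτ₁∫dτ₂ FAM‖ ≤ (3/2)²·B` by domination with the integrable indicator `B·𝟙_{box}` (`norm_integral_le_of_norm_le`) —
the Bochner integral needs no integrability of `FAM` for this direction.

* **`norm_integral_integral_le_of_box`**.

Helper; standard axioms; closes nothing. «The programme SEARCHES and TYPES; no claim about Landau–Siegel zeros,
Theorems 1–2 of arXiv:2211.02515 or a repaired Margin232 until a kernel theorem says so.»
-/

noncomputable section

open MeasureTheory Set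

namespace Summit.Parity.GeneralizedHardyLittlewood.Theorems.BeyondDiagonalBeatsQuarter.OffDiag

/-- The indicator majorant of the unit box is integrable and integrates to `(3/2)·B`. [folklore] -/
theorem integral_indicator_unitBox (B : ℝ) :
    Integrable (fun τ : ℝ ↦ (Set.Ioo (1 / 2 : ℝ) 2).indicator (fun _ ↦ B) τ) ∧
      ∫ τ : ℝ, (Set.Ioo (1 / 2 : ℝ) 2).indicator (fun _ ↦ B) τ = 3 / 2 * B := by
  refine ⟨(integrable_indicator_iff measurableSet_Ioo).mpr (integrableOn_const (by simp)), ?_⟩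
  · rw [integral_indicator_const B measurableSet_Ioo, Measure.real, Real.volume_Ioo, smul_eq_mul]
    norm_num

/-- **A pointwise bound on the open unit box `(1/2,2)²` bounds the iterated integral**: if `F` vanishes off the box and
`‖F‖ ≤ B` on it, then `‖∫dτ₁∫dτ₂ F τ₁ τ₂‖ ≤ (3/2)·((3/2)·B)`. [folklore] -/
theorem norm_integral_integral_le_of_box {F : ℝ → ℝ → ℂ} {B : ℝ}
    (hzero : ∀ τ₁ τ₂ : ℝ, ¬ (τ₁ ∈ Set.Ioo (1 / 2 : ℝ) 2 ∧ τ₂ ∈ Set.Ioo (1 / 2 : ℝ) 2) → F τ₁ τ₂ = 0)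
    (hbound : ∀ τ₁ τ₂ : ℝ, τ₁ ∈ Set.Ioo (1 / 2 : ℝ) 2 → τ₂ ∈ Set.Ioo (1 / 2 : ℝ) 2 → ‖F τ₁ τ₂‖ ≤ B) :
    ‖∫ τ₁, ∫ τ₂, F τ₁ τ₂‖ ≤ 3 / 2 * (3 / 2 * B) := by
  classical
  -- inner integrals
  have hinner : ∀ τ₁ : ℝ, ‖∫ τ₂, F τ₁ τ₂‖ ≤ (Set.Ioo (1 / 2 : ℝ) 2).indicator (fun _ ↦ 3 / 2 * B) τ₁ := by
    intro τ₁
    by_cases h₁ : τ₁ ∈ Set.Ioo (1 / 2 : ℝ) 2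
    · rw [Set.indicator_of_mem h₁]
      obtain ⟨hint, hval⟩ := integral_indicator_unitBox B
      refine (norm_integral_le_of_norm_le hint (Filter.Eventually.of_forall fun τ₂ ↦ ?_)).trans (le_of_eq hval)
      by_cases h₂ : τ₂ ∈ Set.Ioo (1 / 2 : ℝ) 2
      · rw [Set.indicator_of_mem h₂]; exact hbound τ₁ τ₂ h₁ h₂
      · rw [Set.indicator_of_notMem h₂, hzero τ₁ τ₂ (fun h ↦ h₂ h.2), norm_zero]
    · rw [Set.indicator_of_notMem h₁]
      have h0 : (fun τ₂ ↦ F τ₁ τ₂) = fun _ ↦ 0 := funext fun τ₂ ↦ hzero τ₁ τ₂ (fun h ↦ h₁ h.1)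
      rw [h0, integral_zero, norm_zero]
  obtain ⟨hint, hval⟩ := integral_indicator_unitBox (3 / 2 * B)
  exact (norm_integral_le_of_norm_le hint (Filter.Eventually.of_forall hinner)).trans (le_of_eq hval)

end Summit.Parity.GeneralizedHardyLittlewood.Theorems.BeyondDiagonalBeatsQuarter.OffDiag
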